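import Summits.PneNP.PneNP.Theorems.PhaseTwinsPolyDepthTwinsAboveDefs

/-!
# Route PhaseTwins, crux `PolyDepthTwinsAbove` (stmt-PneNP-2719), line `parity-wired-ports`: stub `stub_chargeVisible`

Charge visibility of the ten-vertex CFI complex: in the off-diagonal reference configuration
(vacancies `x(i,0) = 1 - q⁺ =: α`, `x(i,1) = 1 - q⁻ =: β`, `0 < α < β`) the local factor with
satisfied local parity strictly beats the violated one, `Ψ(1) < Ψ(0)`.

Proof: the STRUCTURE FORMULA `F_e(λ; x) = Σ_T λ^{|T|} Π_{(i,a) allowed by T} (1 + λ x(i,a))`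
(`cxWeight_eq_sum_inner`; group the independent sets `J = E ⊕ T` of the complex by their inner
part `T`: inner vertices are pairwise non-adjacent, ends are pairwise non-adjacent, and `E ⊕ T` is
independent iff every end `(i,a) ∈ E` has `bit e S' i ≠ a` for all `S' ∈ T`; then
`Σ_{E ⊆ allowed} Π_E λ x = Π_{allowed} (1 + λ x)`). In the reference configuration the product only
depends on the numbers of allowed ends with `a = 0` / `a = 1`, so
`F_e = Σ_T λ^{|T|} A^{m_e(T)} B^{n_e(T)}` with `A = 1 + λα`, `B = 1 + λβ`; the multiset of statistics
`(|T|, m_e T, n_e T)` over the sixteen inner parts is computed by `decide` (`cxStat_zero`,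
`cxStat_one`), giving `F₀ = A³B³ + λ(B³ + 3A²B) + 3λ²(A + B) + 4λ³ + λ⁴` and
`F₁ = A³B³ + λ(A³ + 3AB²) + 3λ²(A + B) + 4λ³ + λ⁴`, whence
`F₀ - F₁ = λ (B - A)³ = λ⁴ (q⁺ - q⁻)³ > 0`, `F₁ > 0`, and
`Ψ(1) = log (F₁/(1+λ)^{10}) < log (F₀/(1+λ)^{10}) = Ψ(0)`.
-/

noncomputable section

open scoped Classical BigOperators

namespace Summit.PneNP.PneNP.Cruxes.PolyDepthTwinsAbove.ParityWiredPorts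

open Finset
open Literature.ModelTheory.FiniteModelTheory.CFIMatching (bit)

set_option linter.dupNamespace false

variable {M v m κ₁ κ₂ : ℕ}

/-! ## The structure formula of the complex factor -/

/-- Independence in the complex by inner part: `E ⊕ T` is independent iff every end `(i, a)` of `E`
is ALLOWED by `T` (`bit e S' i ≠ a` for every `S' ∈ T`); inner vertices are pairwise non-adjacent,
and so are ends. -/
theorem isIndepSet_disjSum_iff (e : ZMod 2) (E : Finset (Fin 3 × ZMod 2))
    (T : Finset (Fin 2 → ZMod 2)) :
    (cxGraph e).IsIndepSet (↑(E.disjSum T) : Set CxVert) ↔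
      E ⊆ univ.filter fun p => ∀ S' ∈ T, bit e S' p.1 ≠ p.2 := by
  constructor
  · rintro h ⟨i, a⟩ hp
    simp only [mem_filter, mem_univ, true_and]
    intro S' hS' hbit
    have h1 : (Sum.inr S' : CxVert) ∈ (↑(E.disjSum T) : Set CxVert) := by
      rw [mem_coe]; exact inr_mem_disjSum.2 hS'
    have h2 : (Sum.inl (i, a) : CxVert) ∈ (↑(E.disjSum T) : Set CxVert) := by
      rw [mem_coe]; exact inl_mem_disjSum.2 hp
    exact h h1 h2 Sum.inr_ne_inl ((cxGraph_adj e _ _).2 ⟨Sum.inr_ne_inl, Or.inl hbit⟩)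
  · intro h
    have key : ∀ x, x ∈ (↑(E.disjSum T) : Set CxVert) → ∀ y, y ∈ (↑(E.disjSum T) : Set CxVert) →
        ¬ cxRel e x y := by
      rintro (⟨i, a⟩ | S') hx (⟨j, b⟩ | S'') hy hrel
      · exact hrel
      · exact hrel
      · rw [mem_coe, inr_mem_disjSum] at hx
        rw [mem_coe, inl_mem_disjSum] at hy
        exact (mem_filter.1 (h hy)).2 S' hx hrel
      · exact hrel
    intro x hx y hy _ hadj
    rcases ((cxGraph_adj e x y).1 hadj).2 with h1 | h1
    · exact key x hx y hy h1
    · exact key y hy x hx h1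

/-- Reindex a sum over the finsets of a sum type by the two parts. -/
theorem sum_finset_sum_eq {α β N : Type*} [Fintype α] [Fintype β] [AddCommMonoid N]
    (f : Finset (α ⊕ β) → N) :
    ∑ J, f J = ∑ T : Finset β, ∑ E : Finset α, f (E.disjSum T) := by
  rw [Fintype.sum_equiv Finset.sumEquiv.toEquiv f (fun q => f (q.1.disjSum q.2)) fun J =>
      (congrArg f (Finset.toLeft_disjSum_toRight (u := J))).symm,
    Fintype.sum_prod_type, Finset.sum_comm]

/-- **Structure formula.** Grouping the independent sets of the complex by their inner part `T`:
`F_e(λ; x) = Σ_T λ^{|T|} Π_{p allowed by T} (1 + λ x p)`. -/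
theorem cxWeight_eq_sum_inner (e : ZMod 2) (lam : ℝ) (x : Fin 3 × ZMod 2 → ℝ) :
    cxWeight e lam x =
      ∑ T : Finset (Fin 2 → ZMod 2), lam ^ T.card *
        ∏ p ∈ univ.filter (fun p => ∀ S' ∈ T, bit e S' p.1 ≠ p.2), (1 + lam * x p) := by
  unfold cxWeight
  rw [sum_finset_sum_eq]
  refine Finset.sum_congr rfl fun T _ => ?_
  rw [Finset.prod_one_add, Finset.mul_sum, ← Finset.filter_subset_univ, Finset.sum_filter]
  refine Finset.sum_congr rfl fun E _ => ?_
  by_cases hE : E ⊆ univ.filter fun p => ∀ S' ∈ T, bit e S' p.1 ≠ p.2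
  · rw [if_pos ((isIndepSet_disjSum_iff e E T).2 hE), if_pos hE, card_disjSum]
    simp only [inl_mem_disjSum, prod_ite_mem_eq]
    rw [prod_mul_distrib, prod_const, pow_add]
    ring
  · rw [if_neg (mt (isIndepSet_disjSum_iff e E T).1 hE), if_neg hE]

/-! ## Evaluation in the reference configuration -/

/-- In the reference configuration the product over a set of ends only depends on how many of them
have `a = 0` resp. `a = 1`. -/
theorem prod_allowed_ref (lam qp qm : ℝ) (S : Finset (Fin 3 × ZMod 2)) :
    ∏ p ∈ S, (1 + lam * (1 - occP qp qm (decide (p.2 = 0)))) =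
      (1 + lam * (1 - qp)) ^ (S.filter fun p => p.2 = 0).card *
        (1 + lam * (1 - qm)) ^ (S.filter fun p => ¬ p.2 = 0).card := by
  rw [← prod_filter_mul_prod_filter_not S (fun p => p.2 = 0)]
  congr 1
  · rw [← prod_const]
    exact prod_congr rfl fun p hp => by simp [occP, (mem_filter.1 hp).2]
  · rw [← prod_const]
    exact prod_congr rfl fun p hp => by simp [occP, (mem_filter.1 hp).2]

/-- The complex factor in the reference configuration from the multiset `m` of STATISTICS
`(|T|, #allowed ends with a = 0, #allowed ends with a = 1)` of the sixteen inner parts: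
`F_e = Σ_{(k,i,j) ∈ m} λ^k A^i B^j`, `A = 1 + λ(1-q⁺)`, `B = 1 + λ(1-q⁻)`. -/
theorem cxWeight_ref_of_stat (e : ZMod 2) (lam qp qm : ℝ) (m : Multiset (ℕ × ℕ × ℕ))
    (hm : (univ : Finset (Finset (Fin 2 → ZMod 2))).val.map (fun T => (T.card,
        ((univ.filter fun p : Fin 3 × ZMod 2 => ∀ S' ∈ T, bit e S' p.1 ≠ p.2).filter
          fun p => p.2 = 0).card,
        ((univ.filter fun p : Fin 3 × ZMod 2 => ∀ S' ∈ T, bit e S' p.1 ≠ p.2).filter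
          fun p => ¬ p.2 = 0).card)) = m) :
    cxWeight e lam (fun p => 1 - occP qp qm (decide (p.2 = 0))) =
      (m.map fun s => lam ^ s.1 * ((1 + lam * (1 - qp)) ^ s.2.1 * (1 + lam * (1 - qm)) ^ s.2.2)).sum := by
  rw [← hm, cxWeight_eq_sum_inner, Finset.sum_eq_multiset_sum, Multiset.map_map]
  refine congrArg Multiset.sum (Multiset.map_congr rfl fun T _ => ?_)
  simp only [Function.comp_apply]
  rw [prod_allowed_ref]

/-- The sixteen statistics for local charge `0` (the even vectors `000, 011, 101, 110`). -/
theorem cxStat_zero : (univ : Finset (Finset (Fin 2 → ZMod 2))).val.map (fun T => (T.card,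
      ((univ.filter fun p : Fin 3 × ZMod 2 => ∀ S' ∈ T, bit 0 S' p.1 ≠ p.2).filter
        fun p => p.2 = 0).card,
      ((univ.filter fun p : Fin 3 × ZMod 2 => ∀ S' ∈ T, bit 0 S' p.1 ≠ p.2).filter
        fun p => ¬ p.2 = 0).card)) =
    {(0, 3, 3), (1, 0, 3), (1, 2, 1), (1, 2, 1), (1, 2, 1), (2, 0, 1), (2, 0, 1), (2, 0, 1),
      (2, 1, 0), (2, 1, 0), (2, 1, 0), (3, 0, 0), (3, 0, 0), (3, 0, 0), (3, 0, 0), (4, 0, 0)} := by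
  decide

/-- The sixteen statistics for local charge `1` (the odd vectors `001, 010, 100, 111`). -/
theorem cxStat_one : (univ : Finset (Finset (Fin 2 → ZMod 2))).val.map (fun T => (T.card,
      ((univ.filter fun p : Fin 3 × ZMod 2 => ∀ S' ∈ T, bit 1 S' p.1 ≠ p.2).filter
        fun p => p.2 = 0).card,
      ((univ.filter fun p : Fin 3 × ZMod 2 => ∀ S' ∈ T, bit 1 S' p.1 ≠ p.2).filter
        fun p => ¬ p.2 = 0).card)) =
    {(0, 3, 3), (1, 3, 0), (1, 1, 2), (1, 1, 2), (1, 1, 2), (2, 0, 1), (2, 0, 1), (2, 0, 1),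
      (2, 1, 0), (2, 1, 0), (2, 1, 0), (3, 0, 0), (3, 0, 0), (3, 0, 0), (3, 0, 0), (4, 0, 0)} := by
  decide

/-- **`F₀` evaluated**: `F₀ = A³B³ + λ(B³ + 3A²B) + 3λ²(A + B) + 4λ³ + λ⁴`,
`A = 1 + λ(1-q⁺)`, `B = 1 + λ(1-q⁻)`. -/
theorem cxWeight_zero_ref (lam qp qm : ℝ) :
    cxWeight 0 lam (fun p => 1 - occP qp qm (decide (p.2 = 0))) =
      (1 + lam * (1 - qp)) ^ 3 * (1 + lam * (1 - qm)) ^ 3 +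
        lam * ((1 + lam * (1 - qm)) ^ 3 + 3 * (1 + lam * (1 - qp)) ^ 2 * (1 + lam * (1 - qm))) +
        3 * lam ^ 2 * ((1 + lam * (1 - qp)) + (1 + lam * (1 - qm))) + 4 * lam ^ 3 + lam ^ 4 := by
  rw [cxWeight_ref_of_stat 0 lam qp qm _ cxStat_zero]
  simp only [Multiset.insert_eq_cons, Multiset.map_cons, Multiset.sum_cons, Multiset.map_singleton,
    Multiset.sum_singleton]
  ring

/-- **`F₁` evaluated**: `F₁ = A³B³ + λ(A³ + 3AB²) + 3λ²(A + B) + 4λ³ + λ⁴`,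
`A = 1 + λ(1-q⁺)`, `B = 1 + λ(1-q⁻)`. -/
theorem cxWeight_one_ref (lam qp qm : ℝ) :
    cxWeight 1 lam (fun p => 1 - occP qp qm (decide (p.2 = 0))) =
      (1 + lam * (1 - qp)) ^ 3 * (1 + lam * (1 - qm)) ^ 3 +
        lam * ((1 + lam * (1 - qp)) ^ 3 + 3 * (1 + lam * (1 - qp)) * (1 + lam * (1 - qm)) ^ 2) +
        3 * lam ^ 2 * ((1 + lam * (1 - qp)) + (1 + lam * (1 - qm))) + 4 * lam ^ 3 + lam ^ 4 := by
  rw [cxWeight_ref_of_stat 1 lam qp qm _ cxStat_one]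
  simp only [Multiset.insert_eq_cons, Multiset.map_cons, Multiset.sum_cons, Multiset.map_singleton,
    Multiset.sum_singleton]
  ring

/-- **The exact identity** `F₀ - F₁ = λ⁴ (q⁺ - q⁻)³` (`= λ (B - A)³`). -/
theorem cxWeight_zero_sub_one_ref (lam qp qm : ℝ) :
    cxWeight 0 lam (fun p => 1 - occP qp qm (decide (p.2 = 0))) -
        cxWeight 1 lam (fun p => 1 - occP qp qm (decide (p.2 = 0))) =
      lam ^ 4 * (qp - qm) ^ 3 := by
  rw [cxWeight_zero_ref, cxWeight_one_ref]
  ring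

/-- `F₁ > 0` for `0 < λ` and `q⁻, q⁺ < 1`. -/
theorem cxWeight_one_ref_pos {lam qp qm : ℝ} (hlam : 0 < lam) (hqp : qp < 1) (hqm : qm < 1) :
    0 < cxWeight 1 lam (fun p => 1 - occP qp qm (decide (p.2 = 0))) := by
  have hA : 0 < 1 + lam * (1 - qp) := by
    have := mul_pos hlam (sub_pos.2 hqp); linarith
  have hB : 0 < 1 + lam * (1 - qm) := by
    have := mul_pos hlam (sub_pos.2 hqm); linarith
  rw [cxWeight_one_ref]
  generalize 1 + lam * (1 - qp) = A at hA ⊢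
  generalize 1 + lam * (1 - qm) = B at hB ⊢
  positivity

/-! ## The stub -/

/-- **S1 — charge visibility** (stub `stub_chargeVisible` of the line `parity-wired-ports`): for
`0 < λ` and `0 < q⁻ < q⁺ < 1`, `Ψ(1) < Ψ(0)`; indeed `F₀ - F₁ = λ⁴ (q⁺ - q⁻)³ > 0` and `F₁ > 0`
(the hypothesis `0 < q⁻` of the registered signature is not used). -/
theorem stub_chargeVisible {lam qp qm : ℝ} (hlam : 0 < lam) (hqm : 0 < qm) (hlt : qm < qp) (hqp : qp < 1) :
    pwPsi lam qp qm 1 < pwPsi lam qp qm 0 := by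
  have _ := hqm
  have h10 : (0 : ℝ) < (1 + lam) ^ 10 := pow_pos (by linarith) 10
  have hF1 := cxWeight_one_ref_pos hlam hqp (hlt.trans hqp)
  have hF : cxWeight 1 lam (fun p => 1 - occP qp qm (decide (p.2 = 0))) <
      cxWeight 0 lam (fun p => 1 - occP qp qm (decide (p.2 = 0))) := by
    rw [← sub_pos, cxWeight_zero_sub_one_ref]
    exact mul_pos (pow_pos hlam 4) (pow_pos (sub_pos.2 hlt) 3)
  unfold pwPsi cxW
  exact Real.log_lt_log (div_pos hF1 h10) (div_lt_div_of_pos_right hF h10)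

end Summit.PneNP.PneNP.Cruxes.PolyDepthTwinsAbove.ParityWiredPorts
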